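import Mathlib

/-!
# `⟨Γ₀(M₁), Γ₀(M₂)⟩ = Γ₀(gcd(M₁, M₂))`

Blind cell `pub-manin-gamma0`, seat p3 (generation 2).  Paper reference: `proofs/T1_lead.md` §0.4 (SM1)(c) — the group identity used
once in the proof that the level of the newform equals the conductor.  We prove, in `SL(2, ℤ)` and for `M₁, M₂ ≥ 1`,

  `Γ₀(M₁) ⊔ Γ₀(M₂) = Γ₀(gcd(M₁, M₂))`   (`Gamma0_sup_Gamma0`; only `M₁ ≥ 1` is needed).

Proof: for `γ = (a b; c d) ∈ Γ₀(g)`, `g = gcd`, first replace `a` by `a' = a + k c` coprime to `M₁` (left multiplication by `T^k`; the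
existence of `k` is obtained here from Dirichlet's theorem on primes in arithmetic progressions as available in Mathlib — an elementary
CRT argument would also do), then solve `M₂ a' y ≡ -c (mod M₁)` (possible since `gcd(M₂ a', M₁) = g ∣ c`) and observe that
`(1 0; M₂ y 1) · T^k γ` has lower-left entry divisible by `M₁`.  Only Mathlib is imported; no definitions are introduced.
-/

namespace ManinGamma
namespace Gamma0Sup

open Matrix
open scoped MatrixGroups

/-- `Γ₀(M) ≤ Γ₀(d)` when `d ∣ M`. -/
theorem Gamma0_le_Gamma0_of_dvd {d M : ℕ} (h : d ∣ M) :
    CongruenceSubgroup.Gamma0 M ≤ CongruenceSubgroup.Gamma0 d := by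
  intro γ hγ
  rw [CongruenceSubgroup.Gamma0_mem] at hγ ⊢
  have e := congrArg (ZMod.castHom h (ZMod d)) hγ
  rwa [map_intCast, map_zero] at e

/-- From `gcd(a, c) = 1`: some `a + k c` is coprime to a given `M ≥ 1`.  (Via Dirichlet: take a prime `p ≡ a (mod |c|)`, `p > M`.) -/
theorem exists_add_mul_isCoprime (a c : ℤ) (h : IsCoprime a c) {M : ℕ} (hM : 0 < M) :
    ∃ k : ℤ, IsCoprime (a + k * c) (M : ℤ) := by
  rcases eq_or_ne c 0 with hc | hc
  · subst hc
    refine ⟨0, ?_⟩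
    rw [mul_zero, add_zero]
    rcases Int.isUnit_iff.mp (isCoprime_zero_right.mp h) with h1 | h1 <;>
      · rw [h1]; first | exact isCoprime_one_left | exact isCoprime_one_left.neg_left
  · have hq : c.natAbs ≠ 0 := Int.natAbs_ne_zero.mpr hc
    have hcop : IsCoprime a (c.natAbs : ℤ) := by
      rcases Int.natAbs_eq c with e | e
      · rw [← e]; exact h
      · have e' : (c.natAbs : ℤ) = -c := by linarith
        rw [e']
        exact h.neg_right
    obtain ⟨p, hpM, hp, hmod⟩ := Nat.forall_exists_prime_gt_and_zmodEq M hq hcop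
    obtain ⟨k, hk⟩ : c ∣ (p : ℤ) - a := by
      have := (Int.modEq_iff_dvd.mp hmod.symm)
      exact Int.natAbs_dvd.mp this
    refine ⟨k, ?_⟩
    have e : a + k * c = (p : ℤ) := by linear_combination (-1 : ℤ) * hk
    rw [e, Nat.isCoprime_iff_coprime]
    exact (Nat.Prime.coprime_iff_not_dvd hp).mpr (Nat.not_dvd_of_pos_of_lt hM hpM)

/-- The hard inclusion: `Γ₀(gcd(M₁,M₂)) ≤ Γ₀(M₁) ⊔ Γ₀(M₂)` for `M₁ ≥ 1` (any `M₂`; `Γ₀(0)` = upper-triangular). -/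
theorem Gamma0_gcd_le_sup {M₁ M₂ : ℕ} (hM₁ : 0 < M₁) :
    CongruenceSubgroup.Gamma0 (Nat.gcd M₁ M₂) ≤ CongruenceSubgroup.Gamma0 M₁ ⊔ CongruenceSubgroup.Gamma0 M₂ := by
  intro γ hγ
  set a : ℤ := γ 0 0 with ha
  set b : ℤ := γ 0 1 with hb
  set c : ℤ := γ 1 0 with hc
  set d : ℤ := γ 1 1 with hd
  have hdet : a * d - b * c = 1 := by
    have h := Matrix.SpecialLinearGroup.det_coe γ
    rw [Matrix.det_fin_two] at h
    exact h
  -- g ∣ c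
  rw [CongruenceSubgroup.Gamma0_mem] at hγ
  obtain ⟨c'', hc''⟩ := (ZMod.intCast_zmod_eq_zero_iff_dvd c (Nat.gcd M₁ M₂)).mp hγ
  -- a' := a + k c coprime to M₁
  obtain ⟨k, hk⟩ := exists_add_mul_isCoprime a c ⟨d, -b, by linear_combination hdet⟩ hM₁
  obtain ⟨u, v, huv⟩ := hk
  -- Bezout for gcd(M₁, M₂)
  have hg : ((Nat.gcd M₁ M₂ : ℕ) : ℤ) = (M₁ : ℤ) * Int.gcdA M₁ M₂ + (M₂ : ℤ) * Int.gcdB M₁ M₂ := by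
    have := Int.gcd_eq_gcd_ab (M₁ : ℤ) (M₂ : ℤ)
    simpa [Int.gcd_natCast_natCast] using this
  -- solve M₂ a' y + M₁ z = -c
  set a' : ℤ := a + k * c with ha'
  set y : ℤ := -(u * c'' * Int.gcdB M₁ M₂) with hy
  set z : ℤ := -(c'' * Int.gcdA M₁ M₂) - (M₂ : ℤ) * v * c'' * Int.gcdB M₁ M₂ with hz
  have key : (M₂ : ℤ) * y * a' + c = -((M₁ : ℤ) * z) := by
    rw [hy, hz, hc'', hg]
    linear_combination (-(c'' * (M₂ : ℤ) * Int.gcdB ↑M₁ ↑M₂)) * huv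
  -- the matrices
  let L : SL(2, ℤ) := ⟨!![1, 0; (M₂ : ℤ) * y, 1], by simp [Matrix.det_fin_two_of]⟩
  have hL : L ∈ CongruenceSubgroup.Gamma0 M₂ := by
    rw [CongruenceSubgroup.Gamma0_mem]
    show (((!![(1 : ℤ), 0; (M₂ : ℤ) * y, 1]) 1 0 : ℤ) : ZMod M₂) = 0
    simp
  have hT : ∀ n : ℤ, ModularGroup.T ^ n ∈ CongruenceSubgroup.Gamma0 M₁ := by
    intro n
    rw [CongruenceSubgroup.Gamma0_mem]
    have : ((ModularGroup.T ^ n : SL(2, ℤ)) 1 0 : ℤ) = 0 := by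
      show (ModularGroup.T ^ n).1 1 0 = 0
      rw [ModularGroup.coe_T_zpow]; simp
    rw [this]; simp
  have hTγ : ((ModularGroup.T ^ k * γ : SL(2, ℤ)).1) = !![a + k * c, b + k * d; c, d] := by
    rw [Matrix.SpecialLinearGroup.coe_mul, ModularGroup.coe_T_zpow]
    ext i j
    fin_cases i <;> fin_cases j <;> simp [Matrix.mul_apply, Fin.sum_univ_two, ha, hb, hc, hd]
  have hLTγ : ((L * (ModularGroup.T ^ k * γ) : SL(2, ℤ)).1) =
      !![a + k * c, b + k * d; (M₂ : ℤ) * y * (a + k * c) + c, (M₂ : ℤ) * y * (b + k * d) + d] := by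
    rw [Matrix.SpecialLinearGroup.coe_mul, hTγ]
    ext i j
    fin_cases i <;> fin_cases j <;> simp [L, Matrix.mul_apply, Fin.sum_univ_two]
  have hprod : L * (ModularGroup.T ^ k * γ) ∈ CongruenceSubgroup.Gamma0 M₁ := by
    rw [CongruenceSubgroup.Gamma0_mem]
    have e : ((L * (ModularGroup.T ^ k * γ) : SL(2, ℤ)) 1 0 : ℤ) = (M₂ : ℤ) * y * a' + c := by
      show (L * (ModularGroup.T ^ k * γ)).1 1 0 = _
      rw [hLTγ, ha']; simp
    rw [e, key, ZMod.intCast_zmod_eq_zero_iff_dvd]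
    exact ⟨-z, by ring⟩
  -- assemble: γ = T^{-k} * L⁻¹ * (L * (T^k * γ))
  have eγ : γ = ModularGroup.T ^ (-k) * L⁻¹ * (L * (ModularGroup.T ^ k * γ)) := by
    rw [_root_.zpow_neg]; group
  rw [eγ]
  refine Subgroup.mul_mem _ (Subgroup.mul_mem _ ?_ ?_) ?_
  · exact Subgroup.mem_sup_left (hT (-k))
  · exact Subgroup.mem_sup_right (Subgroup.inv_mem _ hL)
  · exact Subgroup.mem_sup_left hprod

/-- **`⟨Γ₀(M₁), Γ₀(M₂)⟩ = Γ₀(gcd(M₁,M₂))`** for `M₁ ≥ 1` (T1_lead §0.4 (SM1)(c)). -/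
theorem Gamma0_sup_Gamma0 {M₁ M₂ : ℕ} (hM₁ : 0 < M₁) :
    CongruenceSubgroup.Gamma0 M₁ ⊔ CongruenceSubgroup.Gamma0 M₂ = CongruenceSubgroup.Gamma0 (Nat.gcd M₁ M₂) :=
  le_antisymm (sup_le (Gamma0_le_Gamma0_of_dvd (Nat.gcd_dvd_left M₁ M₂)) (Gamma0_le_Gamma0_of_dvd (Nat.gcd_dvd_right M₁ M₂)))
    (Gamma0_gcd_le_sup hM₁)

/-- The form used in SM1(c): a function on `ℍ` (or anything) invariant under `Γ₀(N)` and under `Γ₀(N')` is invariant under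
`Γ₀(gcd(N, N'))` — phrased for subgroups: if `Γ₀(N) ≤ S` and `Γ₀(N') ≤ S` then `Γ₀(gcd(N,N')) ≤ S`. -/
theorem Gamma0_gcd_le_of_le {N N' : ℕ} (hN : 0 < N) (S : Subgroup SL(2, ℤ))
    (h₁ : CongruenceSubgroup.Gamma0 N ≤ S) (h₂ : CongruenceSubgroup.Gamma0 N' ≤ S) :
    CongruenceSubgroup.Gamma0 (Nat.gcd N N') ≤ S := by
  rw [← Gamma0_sup_Gamma0 hN]
  exact sup_le h₁ h₂

end Gamma0Sup
end ManinGamma
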